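import Literature.MathematicalPhysics.KineticTheory.LorentzGasMeasurability
import Literature.MathematicalPhysics.KineticTheory.LorentzGasPathMeasure
import Literature.MathematicalPhysics.KineticTheory.LorentzGasEntranceChain
import HarnessLib

/-!
# Generic virtual orbits of the Lorentz gas: almost every path is eventually self-avoiding
(trunk T-KINETIC; topic MathematicalPhysics/KineticTheory; serves the core fact
`Literature.MathematicalPhysics.KineticTheory.gallavotti_lorentz_tendsto_dual` of `LorentzGasGallavotti`)

In Gallavotti's proof of the Boltzmann–Grad limit of the Lorentz gas (Golse 2012, proof of
Thm. 2.1; Spohn 1991, proof of Thm. 8.8 (iii): "as `ε → 0`, `χ → 1` pointwise", `χ` the indicator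
that the `n` scatterers realising a given path do not obstruct it), the term-by-term limit rests on
the fact that for almost every choice of the path coordinates `p = ((u₁, ω₁), …, (uₙ, ωₙ))` the
virtual orbit is in general position: no collision point lies on the line carrying a non-adjacent
free-flight segment. For such paths the realising centres `cᵢ = xᵢ + ε ωᵢ` lie outside the
`ε`-tube of the orbit for all small `ε` (self-avoidance), so that the chain functional of
`GallavottiMeckeChain` evaluates to `φ(end) · P{N(tube) = 0}`.

This file proves the genericity (`Kinetic.ae_goodOrbit`): for `(Leb ⊗ σ)^{⊗n}`-a.e. `p` the orbit
from `z = (x, v)` (`v ≠ 0`, `dim ≥ 2`) is *good* (`Kinetic.GoodOrbit`). The proof is a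
self-reproducing induction on `n`: peeling the first flight `(u, ω)`, the orbit from the reflected
state `z₁` must in addition keep its collision points off the initial line and its lines off the
initial point; off a `Leb ⊗ σ`-null set of `(u, ω)` (normals `ω ⊥ v` or `ω ∥ v`, a `σ`-null cone
section in dimension `≥ 2`, and finitely many durations `u` for each other `ω`) the hypotheses
reproduce. Measurability of the good set comes from the measurable parametrisations of
`LorentzGasMeasurability`.

## Main statements

* `Kinetic.OnLine l a`: `a` lies on the line through `l.1` with direction `l.2`;
  `Kinetic.orbitStates z p`: the states `z₁, …, zₙ` after the collisions of the virtual orbit.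
* `Kinetic.GoodOrbit z ℒ A p`: collision points avoid the lines `ℒ`, orbit lines avoid the points
  `A` and the starting point, and collision point `xᵢ` is off the orbit line `j` for `j ∉ {i-1, i}`.
* `Kinetic.ae_goodOrbit`: goodness holds almost everywhere (Golse 2012, proof of Thm. 2.1: the set
  of pathological paths is negligible).

## References

* F. Golse, *Recent results on the periodic Lorentz gas*, Springer Basel (2011), §2, proof of
  Thm. 2.1 (arXiv:0906.0191).
* H. Spohn, *Large Scale Dynamics of Interacting Particles*, Springer (1991), proof of Thm. 8.8.
-/

open MeasureTheory Metric Real Set Filter Topology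
open scoped InnerProductSpace ENNReal Pointwise

namespace Literature.MathematicalPhysics.KineticTheory

noncomputable section

variable {E : Type*} [NormedAddCommGroup E] [InnerProductSpace ℝ E]

/-! ### Lines -/

/-- `a` lies on the affine line through `l.1` with direction `l.2` (for `l = (x, v)` a kinetic
state: the line carrying the free flight from `x` with velocity `v`). [folklore] -/
def OnLine (l : E × E) (a : E) : Prop :=
  ∃ τ : ℝ, l.1 + τ • l.2 = a

/-- The base point is on the line. [folklore] -/
theorem onLine_self (l : E × E) : OnLine l l.1 := ⟨0, by simp⟩

/-- The points `x + τ v` are on the line of `(x, v)`. [folklore] -/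
theorem onLine_add_smul (l : E × E) (τ : ℝ) : OnLine l (l.1 + τ • l.2) := ⟨τ, rfl⟩

/-- Affine combinations of two points of a line are on the line. [folklore] -/
theorem OnLine.add_smul_sub {l : E × E} {a b : E} (ha : OnLine l a) (hb : OnLine l b) (s : ℝ) :
    OnLine l (a + s • (b - a)) := by
  obtain ⟨τ, rfl⟩ := ha
  obtain ⟨τ', rfl⟩ := hb
  refine ⟨τ + s * (τ' - τ), ?_⟩
  have h : l.1 + τ' • l.2 - (l.1 + τ • l.2) = (τ' - τ) • l.2 := by rw [sub_smul]; abel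
  rw [h, smul_smul, add_smul, add_assoc]

/-- **Closed form of collinearity** (for measurability): `a` is on the line of `(b, w)` iff
`w = 0` and `a = b`, or `w ≠ 0` and `‖w‖² (a - b) = ⟪a - b, w⟫ w` (equality in Cauchy–Schwarz).
[folklore] -/
theorem onLine_iff (l : E × E) (a : E) :
    OnLine l a ↔ (l.2 = 0 ∧ a = l.1) ∨ (l.2 ≠ 0 ∧ (‖l.2‖ ^ 2) • (a - l.1) = ⟪a - l.1, l.2⟫_ℝ • l.2) := by
  constructor
  · rintro ⟨τ, rfl⟩
    by_cases hw : l.2 = 0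
    · left; exact ⟨hw, by rw [hw, smul_zero, add_zero]⟩
    · right
      refine ⟨hw, ?_⟩
      rw [add_sub_cancel_left, real_inner_smul_left, real_inner_self_eq_norm_sq, smul_smul, mul_comm]
  · rintro (⟨hw, rfl⟩ | ⟨hw, h⟩)
    · exact onLine_self l
    · refine ⟨⟪a - l.1, l.2⟫_ℝ / ‖l.2‖ ^ 2, ?_⟩
      have hn : ‖l.2‖ ^ 2 ≠ 0 := pow_ne_zero 2 (norm_ne_zero_iff.2 hw)
      have h' : a - l.1 = (⟪a - l.1, l.2⟫_ℝ / ‖l.2‖ ^ 2) • l.2 := by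
        rw [div_eq_inv_mul, ← smul_smul, ← h, smul_smul, inv_mul_cancel₀ hn, one_smul]
      rw [← h', add_sub_cancel]

/-- **Two points of a line determine it**: if the line `L` does not contain both `x` and `x + v`,
then at most one point `x + u v` of the line of `(x, v)` lies on `L`. [folklore] -/
theorem subsingleton_setOf_onLine_add_smul {L : E × E} {x v : E}
    (hL : ¬ (OnLine L x ∧ OnLine L (x + v))) :
    {u : ℝ | OnLine L (x + u • v)}.Subsingleton := by
  intro u hu u' hu'
  by_contra hne
  have hd : u' - u ≠ 0 := sub_ne_zero.2 (Ne.symm hne)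
  have hdiff : x + u' • v - (x + u • v) = (u' - u) • v := by rw [sub_smul]; abel
  apply hL
  constructor
  · have h := hu.add_smul_sub hu' (-u / (u' - u))
    rw [hdiff, smul_smul, div_mul_cancel₀ _ hd, neg_smul, add_neg_cancel_right] at h
    exact h
  · have h := hu.add_smul_sub hu' ((1 - u) / (u' - u))
    rw [hdiff, smul_smul, div_mul_cancel₀ _ hd, add_assoc, ← add_smul, add_sub_cancel, one_smul] at h
    exact h

/-- **Non-parallel lines meet at most once**: if `v` is not a multiple of `v₁`, then for a given
point `a` at most one base point `x + u v` has `a` on the line of `(x + u v, v₁)`. [folklore] -/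
theorem subsingleton_setOf_onLine_base {x v v₁ a : E} (h : ¬ OnLine ((0 : E), v₁) v) :
    {u : ℝ | OnLine (x + u • v, v₁) a}.Subsingleton := by
  intro u hu u' hu'
  by_contra hne
  obtain ⟨τ, hτ⟩ := hu
  obtain ⟨τ', hτ'⟩ := hu'
  dsimp only at hτ hτ'
  have hd : u - u' ≠ 0 := sub_ne_zero.2 hne
  have hrel : (u - u') • v = (τ' - τ) • v₁ := by
    have := hτ.trans hτ'.symm
    -- `x + u v + τ v₁ = x + u' v + τ' v₁`
    have h2 : u • v + τ • v₁ = u' • v + τ' • v₁ := by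
      have := congrArg (fun w => w - x) this
      simpa [add_assoc, add_sub_cancel_left] using this
    rw [sub_smul, sub_smul, sub_eq_sub_iff_add_eq_add, h2, add_comm]
  apply h
  refine ⟨(τ' - τ) / (u - u'), ?_⟩
  dsimp only
  rw [zero_add, div_eq_inv_mul, ← smul_smul, ← hrel, smul_smul, inv_mul_cancel₀ hd, one_smul]

/-- **Reflection in a generic normal turns the velocity**: if `ω` is a unit vector with `v·ω ≠ 0`
and `ω ∦ v`, then `v` is not a multiple of the reflected velocity `v - 2(v·ω)ω`. [folklore] -/
theorem not_onLine_reflect {v : E} (hv : v ≠ 0) {ω : E} (hω1 : ‖ω‖ = 1) (hvω : ⟪v, ω⟫_ℝ ≠ 0)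
    (hpar : ¬ OnLine ((0 : E), v) ω) :
    ¬ OnLine ((0 : E), v - (2 * ⟪v, ω⟫_ℝ) • ω) v := by
  rintro ⟨τ, hτ⟩
  dsimp only at hτ
  rw [zero_add, smul_sub, smul_smul] at hτ
  -- `(τ - 1) v = 2 τ (v·ω) ω`
  have hrel : (τ - 1) • v = (τ * (2 * ⟪v, ω⟫_ℝ)) • ω := by
    rw [sub_smul, one_smul, sub_eq_iff_eq_add, add_comm, ← sub_eq_iff_eq_add]
    exact hτ
  have hω0 : ω ≠ 0 := by rw [← norm_ne_zero_iff, hω1]; exact one_ne_zero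
  by_cases hτ1 : τ = 1
  · rw [hτ1, sub_self, zero_smul, one_mul] at hrel
    have : (2 * ⟪v, ω⟫_ℝ) = 0 := by
      by_contra hne
      exact hω0 ((smul_eq_zero.1 hrel.symm).resolve_left hne)
    exact hvω (by linarith)
  · have hτ0 : τ ≠ 0 := by
      rintro rfl
      rw [zero_sub, zero_mul, zero_smul, neg_smul, one_smul, neg_eq_zero] at hrel
      exact hv hrel
    have hc : τ * (2 * ⟪v, ω⟫_ℝ) ≠ 0 := mul_ne_zero hτ0 (mul_ne_zero two_ne_zero hvω)
    apply hpar
    refine ⟨(τ - 1) / (τ * (2 * ⟪v, ω⟫_ℝ)), ?_⟩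
    dsimp only
    rw [zero_add, div_eq_mul_inv, mul_comm, ← smul_smul, hrel, smul_smul, inv_mul_cancel₀ hc, one_smul]

/-- From a non-parallel reflected velocity: the initial line `(x, v)` does not contain both the
collision point `x₁ = x + u v` and `x₁ + v₁`. [folklore] -/
theorem not_onLine_and_of_reflect {x v v₁ : E} (hv₁ : v₁ ≠ 0) (h : ¬ OnLine ((0 : E), v₁) v) (u : ℝ) :
    ¬ (OnLine (x, v) (x + u • v) ∧ OnLine (x, v) (x + u • v + v₁)) := by
  rintro ⟨-, ⟨τ, hτ⟩⟩
  dsimp only at hτ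
  have hrel : (τ - u) • v = v₁ := by
    rw [sub_smul]
    have := congrArg (fun w => w - (x + u • v)) hτ
    simpa [add_sub_cancel_left, sub_eq_iff_eq_add] using this
  by_cases hτu : τ - u = 0
  · rw [hτu, zero_smul] at hrel
    exact hv₁ hrel.symm
  · apply h
    refine ⟨(τ - u)⁻¹, ?_⟩
    dsimp only
    rw [zero_add, ← hrel, smul_smul, inv_mul_cancel₀ hτu, one_smul]

/-! ### The states after the collisions -/

/-- The **states after the collisions** of the virtual orbit from `z` with path coordinates `p`:
`orbitStates z ((u, ω) :: p) = z₁ :: orbitStates z₁ p` with `z₁ = (x + u v, v - 2(v·ω)ω)` the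
state just after the first collision (so the `j`-th entry carries the `j`-th free-flight line of
the orbit). [folklore] -/
def orbitStates : E × E → List (ℝ × sphere (0 : E) 1) → List (E × E)
  | _, [] => []
  | z, (u, ω) :: p =>
      (z.1 + u • z.2, z.2 - (2 * ⟪z.2, (ω : E)⟫_ℝ) • (ω : E)) ::
        orbitStates (z.1 + u • z.2, z.2 - (2 * ⟪z.2, (ω : E)⟫_ℝ) • (ω : E)) p

/-- Unfolding `orbitStates` on the empty list. [folklore] -/
@[simp]
theorem orbitStates_nil (z : E × E) : orbitStates z [] = [] := rfl

/-- Unfolding `orbitStates` on a nonempty list. [folklore] -/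
theorem orbitStates_cons (z : E × E) (u : ℝ) (ω : sphere (0 : E) 1) (p : List (ℝ × sphere (0 : E) 1)) :
    orbitStates z ((u, ω) :: p) = (z.1 + u • z.2, z.2 - (2 * ⟪z.2, (ω : E)⟫_ℝ) • (ω : E)) ::
      orbitStates (z.1 + u • z.2, z.2 - (2 * ⟪z.2, (ω : E)⟫_ℝ) • (ω : E)) p := rfl

/-- There are as many post-collision states as collisions. [folklore] -/
@[simp]
theorem length_orbitStates : ∀ (z : E × E) (p : List (ℝ × sphere (0 : E) 1)),
    (orbitStates z p).length = p.length
  | _, [] => rfl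
  | z, (u, ω) :: p => by rw [orbitStates_cons, List.length_cons, List.length_cons, length_orbitStates]

/-- The post-collision velocities have the initial speed. [folklore] -/
theorem norm_snd_of_mem_orbitStates : ∀ (z : E × E) (p : List (ℝ × sphere (0 : E) 1)),
    ∀ l ∈ orbitStates z p, ‖l.2‖ = ‖z.2‖
  | _, [], l, hl => by simp at hl
  | z, (u, ω) :: p, l, hl => by
    rw [orbitStates_cons, List.mem_cons] at hl
    rcases hl with rfl | hl
    · exact Literature.Analysis.FunctionSpaces.norm_sub_two_mul_inner_smul z.2 ω
    · rw [norm_snd_of_mem_orbitStates _ p l hl, Literature.Analysis.FunctionSpaces.norm_sub_two_mul_inner_smul]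

/-- **Every position of the virtual orbit lies on one of its lines** (the initial line or the line
of a post-collision state). [folklore] -/
theorem exists_onLine_virtualState_fst : ∀ (z : E × E) (p : List (ℝ × sphere (0 : E) 1)) (τ : ℝ),
    ∃ l ∈ z :: orbitStates z p, OnLine l (Literature.Analysis.FunctionSpaces.virtualState z p τ).1
  | z, [], τ => ⟨z, List.mem_cons_self, τ, by simp⟩
  | z, (u, ω) :: p, τ => by
    rw [Literature.Analysis.FunctionSpaces.virtualState_cons, orbitStates_cons]
    split_ifs with h
    · exact ⟨z, List.mem_cons_self, τ, rfl⟩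
    · obtain ⟨l, hl, hon⟩ := exists_onLine_virtualState_fst
        (z.1 + u • z.2, z.2 - (2 * ⟪z.2, (ω : E)⟫_ℝ) • (ω : E)) p (τ - u)
      exact ⟨l, List.mem_cons_of_mem _ hl, hon⟩

/-- The realising centres are the collision points shifted by `ε` times the normals:
`virtualCentres ε z p = zipWith (c, (u, ω)) ↦ c + ε ω) (virtualCentres 0 z p) p`; membership form.
[folklore] -/
theorem mem_virtualCentres_iff_zero (ε : ℝ) : ∀ (z : E × E) (p : List (ℝ × sphere (0 : E) 1)) (a : E),
    a ∈ Literature.Analysis.FunctionSpaces.virtualCentres ε z p →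
      ∃ c ∈ Literature.Analysis.FunctionSpaces.virtualCentres 0 z p, ∃ ω : sphere (0 : E) 1, a = c + ε • (ω : E)
  | _, [], a, ha => by simp at ha
  | z, (u, ω) :: p, a, ha => by
    rw [Literature.Analysis.FunctionSpaces.virtualCentres_cons, List.mem_cons] at ha
    rcases ha with rfl | ha
    · refine ⟨z.1 + u • z.2 + (0 : ℝ) • (ω : E), ?_, ω, by rw [zero_smul, add_zero]⟩
      rw [Literature.Analysis.FunctionSpaces.virtualCentres_cons]; exact List.mem_cons_self
    · obtain ⟨c, hc, ω', rfl⟩ := mem_virtualCentres_iff_zero ε _ p a ha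
      refine ⟨c, ?_, ω', rfl⟩
      rw [Literature.Analysis.FunctionSpaces.virtualCentres_cons]; exact List.mem_cons_of_mem _ hc

/-! ### Good orbits -/

/-- **Good (generic) virtual orbits.** The orbit from `z = (x, v)` with path coordinates `p` is
*good* relative to the finite families of lines `ℒ` and points `A` if
(1) its collision points `xᵢ` (`virtualCentres 0 z p`) lie on no line of `ℒ`;
(2) the lines of its post-collision states contain no point of `A`;
(3) nor the starting point `x`;
(4) the collision point `xᵢ` is not on the `j`-th orbit line for `j ∉ {i - 1, i}` (indices:
`(z :: orbitStates z p)[j]`, `(virtualCentres 0 z p)[i]`, `i < n`, `j ≤ n`; the adjacent lines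
`j = i, i + 1` in this numbering do contain it).
For `ℒ = A = []` this is the general-position property of Gallavotti's argument (Golse 2012, proof
of Thm. 2.1: recollisions / revisited obstacles form a negligible set). [folklore] -/
def GoodOrbit (z : E × E) (ℒ : List (E × E)) (A : List E) (p : List (ℝ × sphere (0 : E) 1)) : Prop :=
  (∀ c ∈ Literature.Analysis.FunctionSpaces.virtualCentres 0 z p, ∀ L ∈ ℒ, ¬ OnLine L c) ∧
  (∀ l ∈ orbitStates z p, ∀ a ∈ A, ¬ OnLine l a) ∧
  (∀ l ∈ orbitStates z p, ¬ OnLine l z.1) ∧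
  (∀ i j : ℕ, i < p.length → j ≤ p.length → j ≠ i → j ≠ i + 1 →
    ¬ OnLine ((z :: orbitStates z p).getD j 0) ((Literature.Analysis.FunctionSpaces.virtualCentres 0 z p).getD i 0))

/-- The empty orbit is good. [folklore] -/
theorem goodOrbit_nil (z : E × E) (ℒ : List (E × E)) (A : List E) : GoodOrbit z ℒ A [] := by
  refine ⟨by simp, by simp, by simp, fun i j hi => ?_⟩
  simp at hi

/-- **Goodness reproduces along the orbit** (the induction step of genericity): if the first
collision point `x₁ = x + u v` is off the lines of `ℒ`, the first post-collision line `z₁` avoids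
`A` and `x`, and the orbit from `z₁` is good relative to `z :: ℒ` and `x :: A`, then the orbit from
`z` is good relative to `ℒ` and `A`. [folklore] -/
theorem goodOrbit_cons {z : E × E} {ℒ : List (E × E)} {A : List E} {u : ℝ} {ω : sphere (0 : E) 1}
    {p : List (ℝ × sphere (0 : E) 1)}
    (h1 : ∀ L ∈ ℒ, ¬ OnLine L (z.1 + u • z.2))
    (h2 : ∀ a ∈ A, ¬ OnLine (z.1 + u • z.2, z.2 - (2 * ⟪z.2, (ω : E)⟫_ℝ) • (ω : E)) a)
    (h3 : ¬ OnLine (z.1 + u • z.2, z.2 - (2 * ⟪z.2, (ω : E)⟫_ℝ) • (ω : E)) z.1)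
    (h4 : GoodOrbit (z.1 + u • z.2, z.2 - (2 * ⟪z.2, (ω : E)⟫_ℝ) • (ω : E)) (z :: ℒ) (z.1 :: A) p) :
    GoodOrbit z ℒ A ((u, ω) :: p) := by
  set z₁ : E × E := (z.1 + u • z.2, z.2 - (2 * ⟪z.2, (ω : E)⟫_ℝ) • (ω : E)) with hz₁
  obtain ⟨g1, g2, g3, g4⟩ := h4
  have hx₁ : z.1 + u • z.2 + (0 : ℝ) • (ω : E) = z.1 + u • z.2 := by rw [zero_smul, add_zero]
  refine ⟨?_, ?_, ?_, ?_⟩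
  · intro c hc L hL
    rw [Literature.Analysis.FunctionSpaces.virtualCentres_cons, List.mem_cons] at hc
    rcases hc with rfl | hc
    · rw [hx₁]; exact h1 L hL
    · exact g1 c hc L (List.mem_cons_of_mem _ hL)
  · intro l hl a ha
    rw [orbitStates_cons, List.mem_cons] at hl
    rcases hl with rfl | hl
    · exact h2 a ha
    · exact g2 l hl a (List.mem_cons_of_mem _ ha)
  · intro l hl
    rw [orbitStates_cons, List.mem_cons] at hl
    rcases hl with rfl | hl
    · exact h3
    · exact g2 l hl z.1 List.mem_cons_self
  · intro i j hi hj hji hji1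
    rw [orbitStates_cons, Literature.Analysis.FunctionSpaces.virtualCentres_cons]
    simp only [List.length_cons] at hi hj
    rcases j with _ | j
    · -- the initial line against a later collision point
      rcases i with _ | i
      · exact absurd rfl hji
      · rw [List.getD_cons_zero, List.getD_cons_succ]
        have hi' : i < (Literature.Analysis.FunctionSpaces.virtualCentres 0 z₁ p).length := by
          rw [Literature.Analysis.FunctionSpaces.length_virtualCentres]; omega
        rw [List.getD_eq_getElem _ _ hi']
        exact g1 _ (List.getElem_mem hi') z List.mem_cons_self
    · rw [List.getD_cons_succ]
      rcases i with _ | i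
      · -- the first collision point against a later line
        rw [List.getD_cons_zero, hx₁]
        rcases j with _ | j
        · exact absurd rfl hji1
        · rw [List.getD_cons_succ]
          have hj' : j < (orbitStates z₁ p).length := by rw [length_orbitStates]; omega
          rw [List.getD_eq_getElem _ _ hj']
          exact g3 _ (List.getElem_mem hj')
      · rw [List.getD_cons_succ]
        exact g4 i j (by omega) (by omega) (by omega) (by omega)

/-- **The head conditions of a good orbit**: the later lines avoid the first collision point.
[folklore] -/
theorem GoodOrbit.not_onLine_head {z : E × E} {ℒ : List (E × E)} {A : List E} {u : ℝ}
    {ω : sphere (0 : E) 1} {p : List (ℝ × sphere (0 : E) 1)} (h : GoodOrbit z ℒ A ((u, ω) :: p)) :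
    ∀ l ∈ orbitStates (z.1 + u • z.2, z.2 - (2 * ⟪z.2, (ω : E)⟫_ℝ) • (ω : E)) p,
      ¬ OnLine l (z.1 + u • z.2) := by
  intro l hl
  obtain ⟨j, hj, rfl⟩ := List.getElem_of_mem hl
  have h4 := h.2.2.2 0 (j + 2) (by simp) (by rw [length_orbitStates] at hj; simp; omega)
    (by omega) (by omega)
  rw [orbitStates_cons, Literature.Analysis.FunctionSpaces.virtualCentres_cons, List.getD_cons_succ, List.getD_cons_succ,
    List.getD_cons_zero, zero_smul, add_zero, List.getD_eq_getElem _ _ hj] at h4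
  exact h4

/-- **The head conditions of a good orbit**: the later collision points avoid the initial line.
[folklore] -/
theorem GoodOrbit.not_onLine_init {z : E × E} {ℒ : List (E × E)} {A : List E} {u : ℝ}
    {ω : sphere (0 : E) 1} {p : List (ℝ × sphere (0 : E) 1)} (h : GoodOrbit z ℒ A ((u, ω) :: p)) :
    ∀ c ∈ Literature.Analysis.FunctionSpaces.virtualCentres 0 (z.1 + u • z.2, z.2 - (2 * ⟪z.2, (ω : E)⟫_ℝ) • (ω : E)) p,
      ¬ OnLine z c := by
  intro c hc
  obtain ⟨i, hi, rfl⟩ := List.getElem_of_mem hc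
  have h4 := h.2.2.2 (i + 1) 0 (by rw [Literature.Analysis.FunctionSpaces.length_virtualCentres] at hi; simp; omega) (by simp)
    (by omega) (by omega)
  rw [orbitStates_cons, Literature.Analysis.FunctionSpaces.virtualCentres_cons, List.getD_cons_zero, List.getD_cons_succ,
    List.getD_eq_getElem _ _ hi] at h4
  exact h4

/-- **The tail of a good orbit is good** (relative to no extra lines or points). [folklore] -/
theorem GoodOrbit.tail {z : E × E} {ℒ : List (E × E)} {A : List E} {u : ℝ}
    {ω : sphere (0 : E) 1} {p : List (ℝ × sphere (0 : E) 1)} (h : GoodOrbit z ℒ A ((u, ω) :: p)) :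
    GoodOrbit (z.1 + u • z.2, z.2 - (2 * ⟪z.2, (ω : E)⟫_ℝ) • (ω : E)) [] [] p := by
  refine ⟨fun c _ L hL => by simp at hL, fun l _ a ha => by simp at ha, h.not_onLine_head, ?_⟩
  intro i j hi hj hji hji1
  have h4 := h.2.2.2 (i + 1) (j + 1) (by simp; omega) (by simp; omega) (by omega) (by omega)
  rw [orbitStates_cons, Literature.Analysis.FunctionSpaces.virtualCentres_cons, List.getD_cons_succ, List.getD_cons_succ] at h4
  exact h4


/-! ### Measurability of the good set -/

section Measurability

variable [MeasurableSpace E] [BorelSpace E] [SecondCountableTopology E]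

/-- Collinearity of measurable data is a measurable condition (closed form `onLine_iff`).
[folklore] -/
theorem measurableSet_onLine {β : Type*} [MeasurableSpace β] {f : β → E × E} {g : β → E}
    (hf : Measurable f) (hg : Measurable g) : MeasurableSet {b | OnLine (f b) (g b)} := by
  have h : {b | OnLine (f b) (g b)} =
      ({b | (f b).2 = 0} ∩ {b | g b = (f b).1}) ∪
        ({b | (f b).2 = 0}ᶜ ∩ {b | (‖(f b).2‖ ^ 2) • (g b - (f b).1) = ⟪g b - (f b).1, (f b).2⟫_ℝ • (f b).2}) := by
    ext b
    simp only [mem_setOf_eq, onLine_iff, mem_union, mem_inter_iff, mem_compl_iff]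
  rw [h]
  refine ((measurableSet_eq_fun hf.snd measurable_const).inter (measurableSet_eq_fun hg hf.fst)).union
    ((measurableSet_eq_fun hf.snd measurable_const).compl.inter (measurableSet_eq_fun ?_ ?_))
  · exact (hf.snd.norm.pow_const 2).smul (hg.sub hf.fst)
  · exact ((hg.sub hf.fst).inner hf.snd).smul hf.snd

omit [SecondCountableTopology E] in
/-- Entries of `List.ofFn` of a measurable tuple are measurable (default value off range).
[folklore] -/
theorem measurable_getD_ofFn {α β : Type*} [MeasurableSpace α] [MeasurableSpace β] {n : ℕ}
    {f : β → Fin n → α} (hf : Measurable f) (i : ℕ) (d : α) :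
    Measurable fun b => (List.ofFn (f b)).getD i d := by
  by_cases hi : i < n
  · have : (fun b => (List.ofFn (f b)).getD i d) = fun b => f b ⟨i, hi⟩ := by
      funext b; rw [List.getD_eq_getElem?_getD, List.getElem?_ofFn, dif_pos hi, Option.getD_some]
    rw [this]; exact (measurable_pi_apply _).comp hf
  · have : (fun b => (List.ofFn (f b)).getD i d) = fun _ => d := by
      funext b; rw [List.getD_eq_getElem?_getD, List.getElem?_ofFn, dif_neg hi, Option.getD_none]
    rw [this]; exact measurable_const

omit [MeasurableSpace E] [BorelSpace E] [SecondCountableTopology E] in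
/-- `List.ofFn` of an `(n+1)`-tuple is its head consed to `List.ofFn` of its tail. [folklore] -/
private theorem ofFn_succ'' {α : Type*} {n : ℕ} (q : Fin (n + 1) → α) :
    List.ofFn q = q 0 :: List.ofFn (fun i : Fin n => q i.succ) := List.ofFn_succ

/-- **A measurable parametrisation of the post-collision states**: there is a measurable
`H : (z, q) ↦ (Fin n → E × E)` with `List.ofFn (H (z, q)) = orbitStates z (List.ofFn q)`.
[folklore] -/
theorem exists_measurable_orbitStates (n : ℕ) :
    ∃ H : (E × E) × (Fin n → ℝ × sphere (0 : E) 1) → (Fin n → E × E), Measurable H ∧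
      ∀ p, List.ofFn (H p) = orbitStates p.1 (List.ofFn p.2) := by
  induction n with
  | zero => exact ⟨fun _ => Fin.elim0, measurable_const, fun p => by simp⟩
  | succ n ih =>
    obtain ⟨H, hH, hHeq⟩ := ih
    refine ⟨fun p => Fin.cons (p.1.1 + (p.2 0).1 • p.1.2,
        p.1.2 - (2 * ⟪p.1.2, (((p.2 0).2 : sphere (0 : E) 1) : E)⟫_ℝ) • (((p.2 0).2 : sphere (0 : E) 1) : E))
      (H ((p.1.1 + (p.2 0).1 • p.1.2,
        p.1.2 - (2 * ⟪p.1.2, (((p.2 0).2 : sphere (0 : E) 1) : E)⟫_ℝ) • (((p.2 0).2 : sphere (0 : E) 1) : E)),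
        fun i : Fin n => p.2 i.succ)), ?_, fun p => ?_⟩
    · have hq0 : Measurable fun p : (E × E) × (Fin (n + 1) → ℝ × sphere (0 : E) 1) => p.2 0 :=
        (measurable_pi_apply 0).comp measurable_snd
      have hu : Measurable fun p : (E × E) × (Fin (n + 1) → ℝ × sphere (0 : E) 1) => (p.2 0).1 :=
        hq0.fst
      have hω : Measurable fun p : (E × E) × (Fin (n + 1) → ℝ × sphere (0 : E) 1) =>
          (((p.2 0).2 : sphere (0 : E) 1) : E) := measurable_subtype_coe.comp hq0.snd
      have hx : Measurable fun p : (E × E) × (Fin (n + 1) → ℝ × sphere (0 : E) 1) => p.1.1 :=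
        measurable_fst.fst
      have hv : Measurable fun p : (E × E) × (Fin (n + 1) → ℝ × sphere (0 : E) 1) => p.1.2 :=
        measurable_fst.snd
      have hz₁ : Measurable fun p : (E × E) × (Fin (n + 1) → ℝ × sphere (0 : E) 1) =>
          (p.1.1 + (p.2 0).1 • p.1.2,
            p.1.2 - (2 * ⟪p.1.2, (((p.2 0).2 : sphere (0 : E) 1) : E)⟫_ℝ) •
              (((p.2 0).2 : sphere (0 : E) 1) : E)) :=
        (hx.add (hu.smul hv)).prodMk (hv.sub ((measurable_const.mul (hv.inner hω)).smul hω))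
      have hmap : Measurable fun p : (E × E) × (Fin (n + 1) → ℝ × sphere (0 : E) 1) =>
          ((p.1.1 + (p.2 0).1 • p.1.2,
            p.1.2 - (2 * ⟪p.1.2, (((p.2 0).2 : sphere (0 : E) 1) : E)⟫_ℝ) •
              (((p.2 0).2 : sphere (0 : E) 1) : E)), fun i : Fin n => p.2 i.succ) :=
        hz₁.prodMk (measurable_pi_iff.2 fun i => (measurable_pi_apply _).comp measurable_snd)
      exact measurable_pi_iff.2 fun i => by
        refine Fin.cases ?_ (fun j => ?_) i
        · simp only [Fin.cons_zero]
          exact hz₁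
        · simp only [Fin.cons_succ]
          exact (measurable_pi_apply j).comp (hH.comp hmap)
    · dsimp only
      rw [List.ofFn_succ, Fin.cons_zero]
      simp only [Fin.cons_succ]
      rw [hHeq, ofFn_succ'' p.2]
      rcases p.2 0 with ⟨u, ω⟩
      rw [orbitStates_cons]

/-- **The good set is measurable** in the path coordinates. [folklore] -/
theorem measurableSet_goodOrbit (z : E × E) (ℒ : List (E × E)) (A : List E) (n : ℕ) :
    MeasurableSet {q : Fin n → ℝ × sphere (0 : E) 1 | GoodOrbit z ℒ A (List.ofFn q)} := by
  obtain ⟨G, hG, hGeq⟩ := exists_measurable_virtualCentres (E := E) 0 n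
  obtain ⟨H, hH, hHeq⟩ := exists_measurable_orbitStates (E := E) n
  have hGz : Measurable fun q : Fin n → ℝ × sphere (0 : E) 1 => G (z, q) :=
    hG.comp (measurable_const.prodMk measurable_id)
  have hHz : Measurable fun q : Fin n → ℝ × sphere (0 : E) 1 => H (z, q) :=
    hH.comp (measurable_const.prodMk measurable_id)
  have hG' : ∀ q : Fin n → ℝ × sphere (0 : E) 1, Literature.Analysis.FunctionSpaces.virtualCentres 0 z (List.ofFn q) = List.ofFn (G (z, q)) :=
    fun q => (hGeq (z, q)).symm
  have hH' : ∀ q : Fin n → ℝ × sphere (0 : E) 1, orbitStates z (List.ofFn q) = List.ofFn (H (z, q)) :=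
    fun q => (hHeq (z, q)).symm
  have hZ : ∀ j : ℕ, Measurable fun q : Fin n → ℝ × sphere (0 : E) 1 =>
      (z :: List.ofFn (H (z, q))).getD j 0 := fun j => by
    cases j with
    | zero => simp only [List.getD_cons_zero]; exact measurable_const
    | succ j => simp only [List.getD_cons_succ]; exact measurable_getD_ofFn hHz j 0
  -- the four parts
  have h1 : MeasurableSet {q : Fin n → ℝ × sphere (0 : E) 1 |
      ∀ c ∈ Literature.Analysis.FunctionSpaces.virtualCentres 0 z (List.ofFn q), ∀ L ∈ ℒ, ¬ OnLine L c} := by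
    have heq : {q : Fin n → ℝ × sphere (0 : E) 1 |
        ∀ c ∈ Literature.Analysis.FunctionSpaces.virtualCentres 0 z (List.ofFn q), ∀ L ∈ ℒ, ¬ OnLine L c} =
        ⋂ i : Fin n, ⋂ L ∈ {L | L ∈ ℒ}, {q | ¬ OnLine L (G (z, q) i)} := by
      ext q
      simp only [mem_setOf_eq, mem_iInter]
      rw [hG', List.forall_mem_ofFn_iff]
    rw [heq]
    exact MeasurableSet.iInter fun i => (List.finite_toSet ℒ).measurableSet_biInter fun L _ =>
      (measurableSet_onLine measurable_const ((measurable_pi_apply i).comp hGz)).compl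
  have h2 : MeasurableSet {q : Fin n → ℝ × sphere (0 : E) 1 |
      ∀ l ∈ orbitStates z (List.ofFn q), ∀ a ∈ A, ¬ OnLine l a} := by
    have heq : {q : Fin n → ℝ × sphere (0 : E) 1 |
        ∀ l ∈ orbitStates z (List.ofFn q), ∀ a ∈ A, ¬ OnLine l a} =
        ⋂ j : Fin n, ⋂ a ∈ {a | a ∈ A}, {q | ¬ OnLine (H (z, q) j) a} := by
      ext q
      simp only [mem_setOf_eq, mem_iInter]
      rw [hH', List.forall_mem_ofFn_iff]
    rw [heq]
    exact MeasurableSet.iInter fun j => (List.finite_toSet A).measurableSet_biInter fun a _ =>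
      (measurableSet_onLine ((measurable_pi_apply j).comp hHz) measurable_const).compl
  have h3 : MeasurableSet {q : Fin n → ℝ × sphere (0 : E) 1 |
      ∀ l ∈ orbitStates z (List.ofFn q), ¬ OnLine l z.1} := by
    have heq : {q : Fin n → ℝ × sphere (0 : E) 1 | ∀ l ∈ orbitStates z (List.ofFn q), ¬ OnLine l z.1} =
        ⋂ j : Fin n, {q | ¬ OnLine (H (z, q) j) z.1} := by
      ext q
      simp only [mem_setOf_eq, mem_iInter]
      rw [hH', List.forall_mem_ofFn_iff]
    rw [heq]
    exact MeasurableSet.iInter fun j =>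
      (measurableSet_onLine ((measurable_pi_apply j).comp hHz) measurable_const).compl
  have h4 : MeasurableSet {q : Fin n → ℝ × sphere (0 : E) 1 |
      ∀ i j : ℕ, i < (List.ofFn q).length → j ≤ (List.ofFn q).length → j ≠ i → j ≠ i + 1 →
        ¬ OnLine ((z :: orbitStates z (List.ofFn q)).getD j 0) ((Literature.Analysis.FunctionSpaces.virtualCentres 0 z (List.ofFn q)).getD i 0)} := by
    have heq : {q : Fin n → ℝ × sphere (0 : E) 1 |
        ∀ i j : ℕ, i < (List.ofFn q).length → j ≤ (List.ofFn q).length → j ≠ i → j ≠ i + 1 →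
          ¬ OnLine ((z :: orbitStates z (List.ofFn q)).getD j 0)
            ((Literature.Analysis.FunctionSpaces.virtualCentres 0 z (List.ofFn q)).getD i 0)} =
        ⋂ i ∈ Finset.range n, ⋂ j ∈ Finset.range (n + 1),
          ({q : Fin n → ℝ × sphere (0 : E) 1 | j ≠ i} ∩ {q | j ≠ i + 1} ∩
            {q | OnLine ((z :: List.ofFn (H (z, q))).getD j 0) ((List.ofFn (G (z, q))).getD i 0)})ᶜ := by
      ext q
      simp only [mem_setOf_eq, mem_iInter, mem_compl_iff, mem_inter_iff, Finset.mem_range,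
        List.length_ofFn, not_and]
      rw [hG', hH']
      constructor
      · intro h i hi j hj hji; exact h i j hi (Nat.lt_succ_iff.1 hj) hji.1 hji.2
      · intro h i j hi hj hji hji1; exact h i hi j (Nat.lt_succ_iff.2 hj) ⟨hji, hji1⟩
    rw [heq]
    refine Finset.measurableSet_biInter _ fun i _ => Finset.measurableSet_biInter _ fun j _ => ?_
    exact (((MeasurableSet.const _).inter (MeasurableSet.const _)).inter
      (measurableSet_onLine (hZ j) (measurable_getD_ofFn hGz i 0))).compl
  have heq : {q : Fin n → ℝ × sphere (0 : E) 1 | GoodOrbit z ℒ A (List.ofFn q)} =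
      {q | ∀ c ∈ Literature.Analysis.FunctionSpaces.virtualCentres 0 z (List.ofFn q), ∀ L ∈ ℒ, ¬ OnLine L c} ∩
      {q | ∀ l ∈ orbitStates z (List.ofFn q), ∀ a ∈ A, ¬ OnLine l a} ∩
      {q | ∀ l ∈ orbitStates z (List.ofFn q), ¬ OnLine l z.1} ∩
      {q | ∀ i j : ℕ, i < (List.ofFn q).length → j ≤ (List.ofFn q).length → j ≠ i → j ≠ i + 1 →
        ¬ OnLine ((z :: orbitStates z (List.ofFn q)).getD j 0)
          ((Literature.Analysis.FunctionSpaces.virtualCentres 0 z (List.ofFn q)).getD i 0)} := by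
    ext q
    simp only [GoodOrbit, mem_setOf_eq, mem_inter_iff, and_assoc]
  rw [heq]
  exact ((h1.inter h2).inter h3).inter h4

end Measurability

/-! ### Null sets of first flights -/

section Nullity

variable [FiniteDimensional ℝ E] [MeasurableSpace E] [BorelSpace E]

/-- **Cone sections of proper subspaces are `σ`-null**: for a proper submodule `K`, the unit
vectors in `K` have surface measure `0` (the cone over them lies in `K`, Lebesgue-null).
[folklore] -/
theorem sphereMeasure_setOf_mem_submodule (K : Submodule ℝ E) (hK : K ≠ ⊤) :
    (KineticTheory.sphereMeasure : Measure (sphere (0 : E) 1)) {ω | (ω : E) ∈ K} = 0 := by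
  have hKc : IsClosed (K : Set E) := K.closed_of_finiteDimensional
  have hs : MeasurableSet {ω : sphere (0 : E) 1 | (ω : E) ∈ K} :=
    measurable_subtype_coe hKc.measurableSet
  unfold KineticTheory.sphereMeasure
  rw [Measure.toSphere_apply' _ hs]
  have hsub : Ioo (0 : ℝ) 1 • (Subtype.val '' {ω : sphere (0 : E) 1 | (ω : E) ∈ K}) ⊆ (K : Set E) := by
    intro y hy
    obtain ⟨r, -, w, ⟨ω, hω, rfl⟩, rfl⟩ := Set.mem_smul.1 hy
    exact K.smul_mem r hω
  rw [measure_mono_null hsub (Measure.addHaar_submodule volume K hK), mul_zero]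

/-- **The degenerate normals are `σ`-null** in dimension `≥ 2`: the normals orthogonal to `v` or
parallel to `v` (`v ≠ 0`). [folklore] -/
theorem sphereMeasure_setOf_degenerate {v : E} (hv : v ≠ 0) (hE : 2 ≤ Module.finrank ℝ E) :
    (KineticTheory.sphereMeasure : Measure (sphere (0 : E) 1))
      {ω | ⟪v, (ω : E)⟫_ℝ = 0 ∨ OnLine ((0 : E), v) (ω : E)} = 0 := by
  refine measure_mono_null (t := {ω : sphere (0 : E) 1 | (ω : E) ∈ (ℝ ∙ v)ᗮ} ∪ {ω | (ω : E) ∈ ℝ ∙ v})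
    ?_ ?_
  · rintro ω (h | ⟨τ, h⟩)
    · exact Or.inl (Submodule.mem_orthogonal_singleton_iff_inner_right.2 h)
    · right
      dsimp only at h
      rw [zero_add] at h
      exact Submodule.mem_span_singleton.2 ⟨τ, h⟩
  · refine measure_union_null (sphereMeasure_setOf_mem_submodule _ ?_)
      (sphereMeasure_setOf_mem_submodule _ ?_)
    · intro htop
      have hmem : v ∈ (ℝ ∙ v)ᗮ := htop ▸ Submodule.mem_top
      exact hv (inner_self_eq_zero.1 (Submodule.mem_orthogonal_singleton_iff_inner_right.1 hmem))
    · intro htop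
      have h1 : Module.finrank ℝ (ℝ ∙ v) = 1 := finrank_span_singleton hv
      rw [htop, finrank_top] at h1
      omega

/-- **Countable duration sections off a null set of normals are null**: a measurable set of first
flights `(u, ω)` whose `u`-sections are countable for `σ`-a.e. `ω` is `Leb ⊗ σ`-null. [folklore] -/
theorem measure_prod_null_of_countable_sections {B : Set (ℝ × sphere (0 : E) 1)}
    (hB : MeasurableSet B) {N : Set (sphere (0 : E) 1)}
    (hN : (KineticTheory.sphereMeasure : Measure (sphere (0 : E) 1)) N = 0)
    (h : ∀ ω ∉ N, {u : ℝ | (u, ω) ∈ B}.Countable) :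
    ((volume : Measure ℝ).prod (KineticTheory.sphereMeasure : Measure (sphere (0 : E) 1))) B = 0 := by
  rw [Measure.prod_apply_symm hB]
  have hae : ∀ᵐ ω ∂(KineticTheory.sphereMeasure : Measure (sphere (0 : E) 1)), ω ∉ N :=
    measure_eq_zero_iff_ae_notMem.1 hN
  have hzero : (fun ω : sphere (0 : E) 1 => volume ((fun u : ℝ => (u, ω)) ⁻¹' B)) =ᵐ[KineticTheory.sphereMeasure]
      fun _ => 0 := by
    filter_upwards [hae] with ω hω
    exact (h ω hω).measure_zero volume
  rw [lintegral_congr_ae hzero, lintegral_zero]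

omit [FiniteDimensional ℝ E] [BorelSpace E] in
/-- **Sections to product** (Tonelli for null sets, first coordinate split off): a measurable
property of `(n+1)`-tuples holding, for a.e. head, for a.e. tail, holds a.e. [folklore] -/
theorem ae_pi_succ_of_ae_ae {α : Type*} [MeasurableSpace α] (μ : Measure α) [SigmaFinite μ] {n : ℕ}
    {P : (Fin (n + 1) → α) → Prop} (hP : MeasurableSet {q | P q})
    (h : ∀ᵐ a ∂μ, ∀ᵐ q ∂Measure.pi (fun _ : Fin n => μ), P (Fin.cons a q)) :
    ∀ᵐ q ∂Measure.pi (fun _ : Fin (n + 1) => μ), P q := by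
  set e := MeasurableEquiv.piFinSuccAbove (fun _ : Fin (n + 1) => α) 0 with he
  have hmp : MeasurePreserving e (Measure.pi fun _ => μ) (μ.prod (Measure.pi fun _ : Fin n => μ)) :=
    measurePreserving_piFinSuccAbove (fun _ : Fin (n + 1) => μ) 0
  have hsymm : ∀ (a : α) (y : Fin n → α), e.symm (a, y) = Fin.cons a y := fun a y =>
    Fin.insertNth_zero' a y
  rw [← hmp.symm.map_eq, MeasurableEmbedding.ae_map_iff e.symm.measurableEmbedding]
  have hs : MeasurableSet {c : α × (Fin n → α) | P (Fin.cons c.1 c.2)} := by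
    have : {c : α × (Fin n → α) | P (Fin.cons c.1 c.2)} = e.symm ⁻¹' {q | P q} := by
      ext c
      simp only [mem_setOf_eq, mem_preimage]
      rw [← hsymm c.1 c.2]
    rw [this]
    exact e.symm.measurable hP
  have h2 := (Measure.ae_prod_mem_iff_ae_ae_mem hs).2 h
  filter_upwards [h2] with c hc
  have hc' : e.symm c = Fin.cons c.1 c.2 := by rw [← hsymm c.1 c.2]
  rw [hc']
  exact hc

omit [FiniteDimensional ℝ E] [BorelSpace E] in
/-- **Sections to product**, tail split off: a measurable property of `(n+1)`-tuples holding, for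
a.e. tail, for a.e. head, holds a.e. (`Measure.ae_ae_comm` and `ae_pi_succ_of_ae_ae`). [folklore] -/
theorem ae_pi_succ_of_ae_ae' {α : Type*} [MeasurableSpace α] (μ : Measure α) [SigmaFinite μ] {n : ℕ}
    {P : (Fin (n + 1) → α) → Prop} (hP : MeasurableSet {q | P q})
    (h : ∀ᵐ q ∂Measure.pi (fun _ : Fin n => μ), ∀ᵐ a ∂μ, P (Fin.cons a q)) :
    ∀ᵐ q ∂Measure.pi (fun _ : Fin (n + 1) => μ), P q := by
  refine ae_pi_succ_of_ae_ae μ hP ((Measure.ae_ae_comm (p := fun a q => P (Fin.cons a q)) ?_).2 h)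
  set e := MeasurableEquiv.piFinSuccAbove (fun _ : Fin (n + 1) => α) 0 with he
  have hsymm : ∀ (a : α) (y : Fin n → α), e.symm (a, y) = Fin.cons a y := fun a y =>
    Fin.insertNth_zero' a y
  have : {c : α × (Fin n → α) | P (Fin.cons c.1 c.2)} = e.symm ⁻¹' {q | P q} := by
    ext c
    simp only [mem_setOf_eq, mem_preimage]
    rw [← hsymm c.1 c.2]
  rw [this]
  exact e.symm.measurable hP

/-- **Paths with a prescribed total duration are null**: for `n + 1 ≥ 1` flights, the paths whose
durations sum exactly to `s` form a `(Leb ⊗ σ)^{⊗(n+1)}`-null set (a point section in the first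
duration). [folklore] -/
theorem ae_sum_ofFn_ne (n : ℕ) (s : ℝ) :
    ∀ᵐ q ∂Measure.pi (fun _ : Fin (n + 1) =>
      (volume : Measure ℝ).prod (KineticTheory.sphereMeasure : Measure (sphere (0 : E) 1))),
      ((List.ofFn q).map Prod.fst).sum ≠ s := by
  refine ae_pi_succ_of_ae_ae' _ ?_ (Eventually.of_forall fun q' => ?_)
  · have heq : {q : Fin (n + 1) → ℝ × sphere (0 : E) 1 | ((List.ofFn q).map Prod.fst).sum ≠ s} =
        {q | ∑ i, (q i).1 = s}ᶜ := by
      ext q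
      simp only [mem_setOf_eq, mem_compl_iff, List.map_ofFn, List.sum_ofFn, Function.comp_apply]
    rw [heq]
    exact (measurableSet_eq_fun (Finset.measurable_sum _ fun i _ => (measurable_pi_apply i).fst)
      measurable_const).compl
  · have hset : {a : ℝ × sphere (0 : E) 1 | ¬ ((List.ofFn (Fin.cons a q')).map Prod.fst).sum ≠ s} ⊆
        {s - ((List.ofFn q').map Prod.fst).sum} ×ˢ univ := by
      intro a ha
      simp only [mem_setOf_eq, not_not, List.ofFn_cons, List.map_cons, List.sum_cons] at ha
      exact ⟨by rw [mem_singleton_iff]; linarith, mem_univ _⟩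
    rw [ae_iff]
    exact measure_mono_null hset (by rw [Measure.prod_prod, Real.volume_singleton, zero_mul])

end Nullity

/-! ### Almost every orbit is good -/

section Master

variable [FiniteDimensional ℝ E] [MeasurableSpace E] [BorelSpace E]

/-- **Almost every virtual orbit is in general position** (the genericity behind Gallavotti's
term-by-term limit; Golse 2012, proof of Thm. 2.1: the pathological set of collision parameters is
negligible). In dimension `≥ 2`, for `v ≠ 0`, finitely many lines `ℒ` not containing both `x` and
`x + v` and finitely many points `A` off the line of `z = (x, v)`: for `(Leb ⊗ σ)^{⊗n}`-a.e. path
coordinates the orbit is good (`Kinetic.GoodOrbit`). Induction on `n`: off a `Leb ⊗ σ`-null set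
of first flights `(u, ω)` the hypotheses reproduce for the reflected state with `z :: ℒ` and
`x :: A` (`Kinetic.goodOrbit_cons`). [cite: Golse2011, Thm. 2.1 (proof: negligible pathological set)] -/
theorem ae_goodOrbit (hE : 2 ≤ Module.finrank ℝ E) (n : ℕ) :
    ∀ (z : E × E), z.2 ≠ 0 → ∀ (ℒ : List (E × E)),
      (∀ L ∈ ℒ, ¬ (OnLine L z.1 ∧ OnLine L (z.1 + z.2))) →
      ∀ (A : List E), (∀ a ∈ A, ¬ OnLine z a) →
      ∀ᵐ q ∂Measure.pi (fun _ : Fin n =>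
        (volume : Measure ℝ).prod (KineticTheory.sphereMeasure : Measure (sphere (0 : E) 1))),
        GoodOrbit z ℒ A (List.ofFn q) := by
  induction n with
  | zero =>
    intro z _ ℒ _ A _
    exact Eventually.of_forall fun q => by rw [List.ofFn_zero]; exact goodOrbit_nil z ℒ A
  | succ n ih =>
    intro z hv ℒ hℒ A hA
    refine ae_pi_succ_of_ae_ae _ (measurableSet_goodOrbit z ℒ A (n + 1)) ?_
    -- the exceptional first flights
    set N : Set (ℝ × sphere (0 : E) 1) :=
      ({c | ⟪z.2, ((c.2 : sphere (0 : E) 1) : E)⟫_ℝ = 0} ∪ {c | OnLine ((0 : E), z.2) ((c.2 : sphere (0 : E) 1) : E)}) ∪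
      ((⋃ L ∈ {L | L ∈ ℒ}, {c : ℝ × sphere (0 : E) 1 | OnLine L (z.1 + c.1 • z.2)}) ∪
        ⋃ a ∈ {a | a ∈ z.1 :: A}, {c : ℝ × sphere (0 : E) 1 |
          OnLine (z.1 + c.1 • z.2, z.2 - (2 * ⟪z.2, ((c.2 : sphere (0 : E) 1) : E)⟫_ℝ) •
            ((c.2 : sphere (0 : E) 1) : E)) a}) with hN
    have hu : Measurable fun c : ℝ × sphere (0 : E) 1 => c.1 := measurable_fst
    have hω : Measurable fun c : ℝ × sphere (0 : E) 1 => ((c.2 : sphere (0 : E) 1) : E) :=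
      measurable_subtype_coe.comp measurable_snd
    have hx₁ : Measurable fun c : ℝ × sphere (0 : E) 1 => z.1 + c.1 • z.2 :=
      measurable_const.add (hu.smul measurable_const)
    have hz₁ : Measurable fun c : ℝ × sphere (0 : E) 1 =>
        (z.1 + c.1 • z.2, z.2 - (2 * ⟪z.2, ((c.2 : sphere (0 : E) 1) : E)⟫_ℝ) • ((c.2 : sphere (0 : E) 1) : E)) :=
      hx₁.prodMk (measurable_const.sub ((measurable_const.mul (measurable_const.inner hω)).smul hω))
    have hNm : MeasurableSet N := by
      refine ((measurableSet_eq_fun (measurable_const.inner hω) measurable_const).union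
        (measurableSet_onLine measurable_const hω)).union
        (((List.finite_toSet ℒ).measurableSet_biUnion fun L _ =>
          measurableSet_onLine measurable_const hx₁).union
          ((List.finite_toSet (z.1 :: A)).measurableSet_biUnion fun a _ =>
            measurableSet_onLine hz₁ measurable_const))
    have hN0 : ((volume : Measure ℝ).prod (KineticTheory.sphereMeasure : Measure (sphere (0 : E) 1))) N = 0 := by
      refine measure_prod_null_of_countable_sections hNm (sphereMeasure_setOf_degenerate hv hE)
        fun ω hω => ?_
      simp only [mem_setOf_eq, not_or] at hω
      have hnp : ¬ OnLine ((0 : E), z.2 - (2 * ⟪z.2, (ω : E)⟫_ℝ) • (ω : E)) z.2 :=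
        not_onLine_reflect hv (norm_eq_of_mem_sphere ω) hω.1 hω.2
      have h1 : {u : ℝ | ∃ L ∈ ℒ, OnLine L (z.1 + u • z.2)}.Countable := by
        have heq : {u : ℝ | ∃ L ∈ ℒ, OnLine L (z.1 + u • z.2)} =
            ⋃ L ∈ {L | L ∈ ℒ}, {u | OnLine L (z.1 + u • z.2)} := by
          ext u; simp
        rw [heq]
        exact (List.finite_toSet ℒ).countable.biUnion fun L hL =>
          (subsingleton_setOf_onLine_add_smul (hℒ L hL)).finite.countable
      have h2 : {u : ℝ | ∃ a ∈ z.1 :: A,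
          OnLine (z.1 + u • z.2, z.2 - (2 * ⟪z.2, (ω : E)⟫_ℝ) • (ω : E)) a}.Countable := by
        have heq : {u : ℝ | ∃ a ∈ z.1 :: A,
            OnLine (z.1 + u • z.2, z.2 - (2 * ⟪z.2, (ω : E)⟫_ℝ) • (ω : E)) a} =
            ⋃ a ∈ {a | a ∈ z.1 :: A},
              {u | OnLine (z.1 + u • z.2, z.2 - (2 * ⟪z.2, (ω : E)⟫_ℝ) • (ω : E)) a} := by
          ext u; simp
        rw [heq]
        exact (List.finite_toSet (z.1 :: A)).countable.biUnion fun a _ =>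
          (subsingleton_setOf_onLine_base hnp).finite.countable
      refine (h1.union h2).mono fun u hu => ?_
      simp only [hN, mem_setOf_eq, mem_union, mem_iUnion, exists_prop] at hu
      rcases hu with (h0 | h0) | ⟨L, hL, hL'⟩ | ⟨a, ha, ha'⟩
      · exact absurd h0 hω.1
      · exact absurd h0 hω.2
      · exact Or.inl ⟨L, hL, hL'⟩
      · exact Or.inr ⟨a, ha, ha'⟩
    filter_upwards [measure_eq_zero_iff_ae_notMem.1 hN0] with c hc
    simp only [hN, mem_setOf_eq, mem_union, mem_iUnion, exists_prop, not_or, not_exists, not_and] at hc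
    obtain ⟨⟨hvω, hpar⟩, hL, hAx⟩ := hc
    set z₁ : E × E := (z.1 + c.1 • z.2,
      z.2 - (2 * ⟪z.2, ((c.2 : sphere (0 : E) 1) : E)⟫_ℝ) • ((c.2 : sphere (0 : E) 1) : E)) with hz₁
    have hv₁n : ‖z₁.2‖ = ‖z.2‖ := Literature.Analysis.FunctionSpaces.norm_sub_two_mul_inner_smul z.2 c.2
    have hv₁ : z₁.2 ≠ 0 := by rw [← norm_ne_zero_iff, hv₁n]; exact norm_ne_zero_iff.2 hv
    have hnp : ¬ OnLine ((0 : E), z₁.2) z.2 :=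
      not_onLine_reflect hv (norm_eq_of_mem_sphere c.2) hvω hpar
    have hℒ₁ : ∀ L ∈ z :: ℒ, ¬ (OnLine L z₁.1 ∧ OnLine L (z₁.1 + z₁.2)) := by
      intro L hL'
      rw [List.mem_cons] at hL'
      rcases hL' with rfl | hL'
      · exact not_onLine_and_of_reflect hv₁ hnp c.1
      · exact fun h => hL L hL' h.1
    have hA₁ : ∀ a ∈ z.1 :: A, ¬ OnLine z₁ a := fun a ha => hAx a ha
    filter_upwards [ih z₁ hv₁ (z :: ℒ) hℒ₁ (z.1 :: A) hA₁] with q hq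
    rw [List.ofFn_cons]
    exact goodOrbit_cons hL (fun a ha => hAx a (List.mem_cons_of_mem _ ha)) (hAx z.1 List.mem_cons_self) hq

end Master


/-! ### Self-avoidance of good orbits for small radii -/

section SelfAvoiding

/-- `‖a v + ε ω‖² = a²‖v‖² + 2aε (v·ω) + ε²` for a unit vector `ω`. [folklore] -/
theorem norm_smul_add_smul_sq {v ω : E} (hω : ‖ω‖ = 1) (a ε : ℝ) :
    ‖a • v + ε • ω‖ ^ 2 = a ^ 2 * ‖v‖ ^ 2 + 2 * a * ε * ⟪v, ω⟫_ℝ + ε ^ 2 := by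
  rw [norm_add_sq_real, norm_smul, norm_smul, mul_pow, mul_pow, Real.norm_eq_abs, Real.norm_eq_abs,
    sq_abs, sq_abs, hω, real_inner_smul_left, real_inner_smul_right]
  ring

/-- **An incoming flight stays outside the obstacle it is about to hit**: for a unit normal `ω`
with `v·ω ≥ 0` and `τ ≤ u`, the point `x + τ v` is at distance `≥ ε` from the centre
`x + u v + ε ω` (`ε ≥ 0`). [folklore] -/
theorem le_dist_centre_of_le {v ω : E} (hω : ‖ω‖ = 1) (hvω : 0 ≤ ⟪v, ω⟫_ℝ) {ε : ℝ} (hε : 0 ≤ ε)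
    (x : E) {u τ : ℝ} (hτ : τ ≤ u) :
    ε ≤ dist (x + u • v + ε • ω) (x + τ • v) := by
  have hd : dist (x + u • v + ε • ω) (x + τ • v) = ‖(u - τ) • v + ε • ω‖ := by
    rw [dist_eq_norm, sub_smul]; congr 1; abel
  rw [hd]
  refine le_of_pow_le_pow_left₀ two_ne_zero (norm_nonneg _) ?_
  rw [norm_smul_add_smul_sq hω]
  nlinarith [sq_nonneg (u - τ), sq_nonneg ‖v‖, mul_nonneg (mul_nonneg (sub_nonneg.2 hτ) hε) hvω]

/-- **Splitting the tube at the first collision**: a point of the tube of `(u, ω) :: p`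
(`0 ≤ u ≤ t`) is within `ε` of the first flight before time `u`, or in the tube of the tail orbit
from the reflected state over the remaining time `t - u`. [folklore] -/
theorem mem_virtualTube_cons {ε : ℝ} {z : E × E} {t u : ℝ} (hut : u ≤ t)
    {ω : sphere (0 : E) 1} {p : List (ℝ × sphere (0 : E) 1)} {a : E}
    (ha : a ∈ virtualTube ε z t ((u, ω) :: p)) :
    (∃ τ ∈ Ico (0 : ℝ) u, dist a (z.1 + τ • z.2) < ε) ∨
      a ∈ virtualTube ε (z.1 + u • z.2, z.2 - (2 * ⟪z.2, (ω : E)⟫_ℝ) • (ω : E)) (t - u) p := by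
  rw [mem_virtualTube] at ha
  rcases ha with ⟨τ, hτ, hlt⟩ | hle
  · by_cases hτu : τ < u
    · left
      rw [Literature.Analysis.FunctionSpaces.virtualState_cons_of_lt z ω p hτu] at hlt
      exact ⟨τ, ⟨hτ.1, hτu⟩, hlt⟩
    · right
      rw [Literature.Analysis.FunctionSpaces.virtualState_cons_of_le z ω p (not_lt.1 hτu)] at hlt
      rw [mem_virtualTube]
      exact Or.inl ⟨τ - u, ⟨sub_nonneg.2 (not_lt.1 hτu), sub_le_sub_right hτ.2 u⟩, hlt⟩
  · right
    rw [Literature.Analysis.FunctionSpaces.virtualState_cons_of_le z ω p hut] at hle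
    rw [mem_virtualTube]
    exact Or.inr hle

omit [InnerProductSpace ℝ E] in
/-- A continuous curve on a compact parameter interval missing a point stays a positive distance
away from it. [folklore] -/
theorem exists_pos_le_dist_of_forall_ne {f : ℝ → E} (hf : Continuous f) {a b : ℝ} (hab : a ≤ b)
    {c : E} (hne : ∀ τ ∈ Icc a b, f τ ≠ c) :
    ∃ δ : ℝ, 0 < δ ∧ ∀ τ ∈ Icc a b, δ ≤ dist c (f τ) := by
  obtain ⟨τ₀, hτ₀, hmin⟩ := (isCompact_Icc (a := a) (b := b)).exists_isMinOn (nonempty_Icc.2 hab)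
    ((continuous_const.dist hf).continuousOn (s := Icc a b))
  refine ⟨dist c (f τ₀), dist_pos.2 (hne τ₀ hτ₀).symm, fun τ hτ => ?_⟩
  exact hmin hτ

/-- Finitely many positive thresholds have a common positive lower bound. [folklore] -/
theorem exists_pos_forall_mem {α : Type*} {P : α → ℝ → Prop} :
    ∀ {l : List α}, (∀ a ∈ l, ∃ ε₀ : ℝ, 0 < ε₀ ∧ ∀ ε, 0 < ε → ε < ε₀ → P a ε) →
      ∃ ε₀ : ℝ, 0 < ε₀ ∧ ∀ a ∈ l, ∀ ε, 0 < ε → ε < ε₀ → P a ε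
  | [], _ => ⟨1, one_pos, fun a ha => by simp at ha⟩
  | a :: l, h => by
    obtain ⟨ε₁, hε₁, h₁⟩ := h a List.mem_cons_self
    obtain ⟨ε₂, hε₂, h₂⟩ := exists_pos_forall_mem (l := l) fun b hb => h b (List.mem_cons_of_mem _ hb)
    refine ⟨min ε₁ ε₂, lt_min hε₁ hε₂, fun b hb ε hε hlt => ?_⟩
    rw [List.mem_cons] at hb
    rcases hb with rfl | hb
    · exact h₁ ε hε (hlt.trans_le (min_le_left _ _))
    · exact h₂ b hb ε hε (hlt.trans_le (min_le_right _ _))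

/-- **The shifted starting point avoids the tube of a generic orbit** (the recollision estimate,
deterministic part): let the orbit from `z₁ = (x₁, v₁)` (`v₁ ≠ 0`) have positive durations with sum
`< t₁` and its later lines avoid `x₁`; let `ω` be a unit vector with `v₁·ω ≤ 0` (the normal of the
obstacle just hit). Then for all small `ε > 0` the centre `x₁ + ε ω` is outside the `ε`-tube of the
orbit: the first flight recedes from it, and the later flights stay a fixed distance from `x₁`.
[folklore] -/
theorem exists_forall_start_notMem_virtualTube {z₁ : E × E} (hv₁ : z₁.2 ≠ 0) {ω : E} (hω : ‖ω‖ = 1)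
    (hvω : ⟪z₁.2, ω⟫_ℝ ≤ 0) :
    ∀ {p : List (ℝ × sphere (0 : E) 1)} {t₁ : ℝ}, (∀ q ∈ p, 0 < q.1) → (p.map Prod.fst).sum < t₁ →
      (∀ l ∈ orbitStates z₁ p, ¬ OnLine l z₁.1) →
      ∃ ε₀ : ℝ, 0 < ε₀ ∧ ∀ ε, 0 < ε → ε < ε₀ → z₁.1 + ε • ω ∉ virtualTube ε z₁ t₁ p := by
  -- the reflected normal: `v₁ = v₁' - 2(v₁'·(-ω))(-ω)` bookkeeping is avoided by writing the first
  -- flight directly as `x₁ + τ v₁` and using `‖τ v₁ - ε ω‖² ≥ ε²` from `v₁·ω ≤ 0`.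
  have hfirst : ∀ {ε : ℝ}, 0 ≤ ε → ∀ {τ : ℝ}, 0 ≤ τ → ε ≤ dist (z₁.1 + ε • ω) (z₁.1 + τ • z₁.2) := by
    intro ε hε τ hτ
    have hd : dist (z₁.1 + ε • ω) (z₁.1 + τ • z₁.2) = ‖(-τ) • z₁.2 + ε • ω‖ := by
      rw [dist_eq_norm, neg_smul]; congr 1; abel
    rw [hd]
    refine le_of_pow_le_pow_left₀ two_ne_zero (norm_nonneg _) ?_
    rw [norm_smul_add_smul_sq hω]
    nlinarith [sq_nonneg τ, sq_nonneg ‖z₁.2‖, mul_nonneg (mul_nonneg hτ hε) (neg_nonneg.2 hvω)]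
  have hfirst' : ∀ {ε : ℝ}, 0 ≤ ε → ∀ {τ : ℝ}, 0 < τ → ε < dist (z₁.1 + ε • ω) (z₁.1 + τ • z₁.2) := by
    intro ε hε τ hτ
    have hd : dist (z₁.1 + ε • ω) (z₁.1 + τ • z₁.2) = ‖(-τ) • z₁.2 + ε • ω‖ := by
      rw [dist_eq_norm, neg_smul]; congr 1; abel
    rw [hd]
    refine lt_of_pow_lt_pow_left₀ 2 (norm_nonneg _) ?_
    rw [norm_smul_add_smul_sq hω]
    have hvn : 0 < ‖z₁.2‖ := norm_pos_iff.2 hv₁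
    nlinarith [mul_pos (mul_pos hτ hτ) (mul_pos hvn hvn), mul_nonneg (mul_nonneg hτ.le hε) (neg_nonneg.2 hvω)]
  intro p
  cases p with
  | nil =>
    intro t₁ _ hsum _
    simp only [List.map_nil, List.sum_nil] at hsum
    refine ⟨1, one_pos, fun ε hε _ hmem => ?_⟩
    rw [mem_virtualTube] at hmem
    simp only [Literature.Analysis.FunctionSpaces.virtualState_nil] at hmem
    rcases hmem with ⟨τ, hτ, hlt⟩ | hle
    · exact (not_lt.2 (hfirst hε.le hτ.1)) hlt
    · exact (not_le.2 (hfirst' hε.le hsum)) hle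
  | cons q p =>
    obtain ⟨u', ω'⟩ := q
    intro t₁ hdur hsum havoid
    have hu' : 0 < u' := hdur (u', ω') List.mem_cons_self
    have hdur' : ∀ q ∈ p, 0 < q.1 := fun q hq => hdur q (List.mem_cons_of_mem _ hq)
    simp only [List.map_cons, List.sum_cons] at hsum
    have hsum0 : 0 ≤ (p.map Prod.fst).sum := List.sum_nonneg fun a ha => by
      obtain ⟨q, hq, rfl⟩ := List.mem_map.1 ha; exact (hdur' q hq).le
    set z₂ : E × E := (z₁.1 + u' • z₁.2,
      z₁.2 - (2 * ⟪z₁.2, (ω' : E)⟫_ℝ) • (ω' : E)) with hz₂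
    -- the later flights stay away from `x₁`
    have hne : ∀ τ ∈ Icc (0 : ℝ) (t₁ - u'), (Literature.Analysis.FunctionSpaces.virtualState z₂ p τ).1 ≠ z₁.1 := by
      intro τ _ heq
      obtain ⟨l, hl, hon⟩ := exists_onLine_virtualState_fst z₂ p τ
      rw [heq] at hon
      have hl' : l ∈ orbitStates z₁ ((u', ω') :: p) := by rw [orbitStates_cons]; exact hl
      exact havoid l hl' hon
    obtain ⟨δ, hδ, hδle⟩ := exists_pos_le_dist_of_forall_ne (continuous_virtualState_fst p z₂ hdur')
      (by linarith) hne
    refine ⟨δ / 2, by positivity, fun ε hε hεδ hmem => ?_⟩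
    rcases mem_virtualTube_cons (by linarith) hmem with ⟨τ, hτ, hlt⟩ | hmem'
    · exact (not_lt.2 (hfirst hε.le hτ.1)) hlt
    · -- distance to the later flights is `≥ δ - ε > ε`
      have hfar : ∀ τ ∈ Icc (0 : ℝ) (t₁ - u'), ε < dist (z₁.1 + ε • ω) (Literature.Analysis.FunctionSpaces.virtualState z₂ p τ).1 := by
        intro τ hτ
        have h1 := hδle τ hτ
        have h2 : dist z₁.1 (Literature.Analysis.FunctionSpaces.virtualState z₂ p τ).1 ≤
            dist z₁.1 (z₁.1 + ε • ω) + dist (z₁.1 + ε • ω) (Literature.Analysis.FunctionSpaces.virtualState z₂ p τ).1 := dist_triangle _ _ _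
        have h3 : dist z₁.1 (z₁.1 + ε • ω) = ε := by
          rw [dist_eq_norm, sub_add_cancel_left, norm_neg, norm_smul, Real.norm_eq_abs, abs_of_pos hε,
            hω, mul_one]
        linarith
      rw [mem_virtualTube] at hmem'
      rcases hmem' with ⟨τ, hτ, hlt⟩ | hle
      · exact (not_lt.2 (hfar τ hτ).le) hlt
      · exact (not_le.2 (hfar (t₁ - u') ⟨by linarith, le_rfl⟩)) hle

/-- **Good orbits are eventually self-avoiding** (the deterministic half of "`χ → 1` pointwise",
Spohn 1991, proof of Thm. 8.8 (iii); Golse 2012, proof of Thm. 2.1): if the orbit from `z`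
(`v ≠ 0`) with path coordinates `p` has nonvanishing weight (all reflections transversal and
incoming), positive durations with sum `< t`, and is good, then for all small `ε > 0` every
realising centre `xᵢ + ε ωᵢ` lies outside the `ε`-tube of the orbit over `[0, t]`.
[cite: Golse2011, Thm. 2.1 (proof: the Markov part, obstacles met in order and no other in the tube)] -/
theorem exists_forall_notMem_virtualTube :
    ∀ (p : List (ℝ × sphere (0 : E) 1)) (z : E × E) (t : ℝ), z.2 ≠ 0 → pathWeight z p ≠ 0 →
      (∀ q ∈ p, 0 < q.1) → (p.map Prod.fst).sum < t → GoodOrbit z [] [] p →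
      ∃ ε₀ : ℝ, 0 < ε₀ ∧ ∀ ε, 0 < ε → ε < ε₀ →
        ∀ a ∈ Literature.Analysis.FunctionSpaces.virtualCentres ε z p, a ∉ virtualTube ε z t p
  | [], z, t, _, _, _, _, _ => ⟨1, one_pos, fun ε _ _ a ha => by simp at ha⟩
  | (u, ω) :: p, z, t, hv, hW, hdur, hsum, hgood => by
    have hω1 : ‖(ω : E)‖ = 1 := norm_eq_of_mem_sphere ω
    rw [pathWeight_cons, mul_ne_zero_iff, Ne, ENNReal.ofReal_eq_zero, not_le] at hW
    obtain ⟨hvω', hW₁⟩ := hW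
    have hvω : 0 < ⟪z.2, (ω : E)⟫_ℝ := by
      rcases lt_max_iff.1 hvω' with h | h
      · exact h
      · exact absurd h (lt_irrefl 0)
    have hu : 0 < u := hdur (u, ω) List.mem_cons_self
    have hdur' : ∀ q ∈ p, 0 < q.1 := fun q hq => hdur q (List.mem_cons_of_mem _ hq)
    simp only [List.map_cons, List.sum_cons] at hsum
    have hsum0 : 0 ≤ (p.map Prod.fst).sum := List.sum_nonneg fun a ha => by
      obtain ⟨q, hq, rfl⟩ := List.mem_map.1 ha; exact (hdur' q hq).le
    set z₁ : E × E := (z.1 + u • z.2, z.2 - (2 * ⟪z.2, (ω : E)⟫_ℝ) • (ω : E)) with hz₁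
    have hv₁n : ‖z₁.2‖ = ‖z.2‖ := Literature.Analysis.FunctionSpaces.norm_sub_two_mul_inner_smul z.2 ω
    have hv₁ : z₁.2 ≠ 0 := by rw [← norm_ne_zero_iff, hv₁n]; exact norm_ne_zero_iff.2 hv
    have hW₁' : pathWeight z₁ p ≠ 0 := by
      rwa [pathWeight_eq_of_snd_eq p (show z₁.2 = (z.1, z.2 - (2 * ⟪z.2, (ω : E)⟫_ℝ) • (ω : E)).2 from rfl)]
    have hsum₁ : (p.map Prod.fst).sum < t - u := by linarith
    -- (d) the tail, by induction
    obtain ⟨ε₁, hε₁, h₁⟩ := exists_forall_notMem_virtualTube p z₁ (t - u) hv₁ hW₁' hdur' hsum₁ hgood.tail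
    -- (b) the first centre against the tail orbit
    have hvω₁ : ⟪z₁.2, (ω : E)⟫_ℝ ≤ 0 := by
      have : ⟪z₁.2, (ω : E)⟫_ℝ = -⟪z.2, (ω : E)⟫_ℝ := by
        rw [hz₁]; dsimp only
        rw [inner_sub_left, real_inner_smul_left, real_inner_self_eq_norm_sq, hω1]; ring
      rw [this]; linarith
    obtain ⟨ε₂, hε₂, h₂⟩ := exists_forall_start_notMem_virtualTube hv₁ hω1 hvω₁ hdur' hsum₁
      hgood.not_onLine_head
    -- (c) the later centres against the first flight
    have hfirst : Continuous fun τ : ℝ => z.1 + τ • z.2 := continuous_const.add (continuous_id.smul continuous_const)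
    have h₃' : ∀ c ∈ Literature.Analysis.FunctionSpaces.virtualCentres 0 z₁ p, ∃ ε₀ : ℝ, 0 < ε₀ ∧ ∀ ε, 0 < ε → ε < ε₀ →
        ∀ (ω' : E), ‖ω'‖ = 1 → ∀ τ ∈ Icc (0 : ℝ) u, ε ≤ dist (c + ε • ω') (z.1 + τ • z.2) := by
      intro c hc
      have hne : ∀ τ ∈ Icc (0 : ℝ) u, z.1 + τ • z.2 ≠ c := fun τ _ heq =>
        hgood.not_onLine_init c hc ⟨τ, heq⟩
      obtain ⟨δ, hδ, hδle⟩ := exists_pos_le_dist_of_forall_ne hfirst hu.le hne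
      refine ⟨δ / 2, by positivity, fun ε hε hεδ ω' hω' τ hτ => ?_⟩
      have h1 := hδle τ hτ
      have h2 : dist c (z.1 + τ • z.2) ≤ dist c (c + ε • ω') + dist (c + ε • ω') (z.1 + τ • z.2) :=
        dist_triangle _ _ _
      have h3 : dist c (c + ε • ω') = ε := by
        rw [dist_eq_norm, sub_add_cancel_left, norm_neg, norm_smul, Real.norm_eq_abs, abs_of_pos hε,
          hω', mul_one]
      linarith
    obtain ⟨ε₃, hε₃, h₃⟩ := exists_pos_forall_mem h₃'
    -- assemble
    refine ⟨min ε₁ (min ε₂ ε₃), lt_min hε₁ (lt_min hε₂ hε₃), fun ε hε hlt a ha hmem => ?_⟩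
    have hlt₁ : ε < ε₁ := hlt.trans_le (min_le_left _ _)
    have hlt₂ : ε < ε₂ := hlt.trans_le ((min_le_right _ _).trans (min_le_left _ _))
    have hlt₃ : ε < ε₃ := hlt.trans_le ((min_le_right _ _).trans (min_le_right _ _))
    rw [Literature.Analysis.FunctionSpaces.virtualCentres_cons, List.mem_cons] at ha
    rcases ha with rfl | ha
    · -- the first centre `x + u v + ε ω`
      rcases mem_virtualTube_cons (by linarith) hmem with ⟨τ, hτ, hltd⟩ | hmem'
      · exact (not_lt.2 (le_dist_centre_of_le hω1 hvω.le hε.le z.1 hτ.2.le)) hltd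
      · exact h₂ ε hε hlt₂ hmem'
    · -- a later centre `c + ε ω'`
      rcases mem_virtualTube_cons (by linarith) hmem with ⟨τ, hτ, hltd⟩ | hmem'
      · obtain ⟨c, hc, ω', rfl⟩ := mem_virtualCentres_iff_zero ε z₁ p a ha
        exact (not_lt.2 (h₃ c hc ε hε hlt₃ ω' (norm_eq_of_mem_sphere ω') τ (Ico_subset_Icc_self hτ))) hltd
      · exact h₁ ε hε hlt₁ a ha hmem'

end SelfAvoiding

/-! ### Realising centres of a weighted path -/

section HitChain

/-- A nonvanishing path weight means a transversal incoming first reflection and a nonvanishing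
weight of the tail. [folklore] -/
theorem pathWeight_cons_ne_zero_iff (z : E × E) (u : ℝ) (ω : sphere (0 : E) 1)
    (p : List (ℝ × sphere (0 : E) 1)) :
    pathWeight z ((u, ω) :: p) ≠ 0 ↔
      0 < ⟪z.2, (ω : E)⟫_ℝ ∧ pathWeight (z.1, z.2 - (2 * ⟪z.2, (ω : E)⟫_ℝ) • (ω : E)) p ≠ 0 := by
  rw [pathWeight_cons, mul_ne_zero_iff, Ne, ENNReal.ofReal_eq_zero, not_le, lt_max_iff,
    or_iff_left (lt_irrefl 0)]

/-- **The realising centres of a weighted path form a hit chain** (`ε > 0`, `v ≠ 0`): each centre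
`xᵢ + ε ωᵢ` is entered transversally by the `i`-th flight, whose hit state is the next virtual
state (`Kinetic.hitState_param`). [folklore] -/
theorem isHitChain_virtualCentres {ε : ℝ} (hε : 0 < ε) :
    ∀ (p : List (ℝ × sphere (0 : E) 1)) (z : E × E), z.2 ≠ 0 → pathWeight z p ≠ 0 →
      IsHitChain ε z (Literature.Analysis.FunctionSpaces.virtualCentres ε z p)
  | [], z, _, _ => by rw [Literature.Analysis.FunctionSpaces.virtualCentres_nil]; exact isHitChain_nil ε z
  | (u, ω) :: p, (x, v), hv, hW => by
    rw [pathWeight_cons_ne_zero_iff] at hW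
    obtain ⟨hvω, hW₁⟩ := hW
    dsimp only at hvω hW₁ hv
    rw [Literature.Analysis.FunctionSpaces.virtualCentres_cons, isHitChain_cons]
    dsimp only
    refine ⟨exists_dist_param_lt x hv hε u ω hvω.ne', ?_⟩
    rw [hitState_param hv hε u ω hvω]
    have hv₁ : v - (2 * ⟪v, (ω : E)⟫_ℝ) • (ω : E) ≠ 0 := by
      rw [← norm_ne_zero_iff, Literature.Analysis.FunctionSpaces.norm_sub_two_mul_inner_smul]; exact norm_ne_zero_iff.2 hv
    refine isHitChain_virtualCentres hε p _ hv₁ ?_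
    rwa [pathWeight_eq_of_snd_eq p (show (x + u • v, v - (2 * ⟪v, (ω : E)⟫_ℝ) • (ω : E)).2 =
      (x, v - (2 * ⟪v, (ω : E)⟫_ℝ) • (ω : E)).2 from rfl)]

/-- **Round trip**: the path coordinates of the realising centres of a weighted path are the path
itself (`ε > 0`, `v ≠ 0`; `Kinetic.chainParams_cons_param` along the recursion). [folklore] -/
theorem chainParams_virtualCentres (ω₀ : sphere (0 : E) 1) {ε : ℝ} (hε : 0 < ε) :
    ∀ (p : List (ℝ × sphere (0 : E) 1)) (z : E × E), z.2 ≠ 0 → pathWeight z p ≠ 0 →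
      chainParams ω₀ ε z (Literature.Analysis.FunctionSpaces.virtualCentres ε z p) = p
  | [], z, _, _ => by rw [Literature.Analysis.FunctionSpaces.virtualCentres_nil, chainParams_nil]
  | (u, ω) :: p, (x, v), hv, hW => by
    rw [pathWeight_cons_ne_zero_iff] at hW
    obtain ⟨hvω, hW₁⟩ := hW
    dsimp only at hvω hW₁ hv
    rw [Literature.Analysis.FunctionSpaces.virtualCentres_cons]
    dsimp only
    rw [chainParams_cons_param ω₀ hε hv u ω hvω]
    have hv₁ : v - (2 * ⟪v, (ω : E)⟫_ℝ) • (ω : E) ≠ 0 := by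
      rw [← norm_ne_zero_iff, Literature.Analysis.FunctionSpaces.norm_sub_two_mul_inner_smul]; exact norm_ne_zero_iff.2 hv
    rw [chainParams_virtualCentres ω₀ hε p _ hv₁]
    rwa [pathWeight_eq_of_snd_eq p (show (x + u • v, v - (2 * ⟪v, (ω : E)⟫_ℝ) • (ω : E)).2 =
      (x, v - (2 * ⟪v, (ω : E)⟫_ℝ) • (ω : E)).2 from rfl)]

end HitChain

end

end Literature.MathematicalPhysics.KineticTheory
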